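import Literature.NumberTheory.LFunctions.LogZetaClassicalRegion
import Literature.NumberTheory.LFunctions.MontgomeryVaughanLogMeansProofs
import Mathlib.Analysis.SpecialFunctions.Complex.LogBounds
import HarnessLib

/-!
# The second-order part of the logarithm of an Euler product: `Σ_p (−Log(1 − c_p p^{−s}) − c_p p^{−s})`

Topic `Literature/NumberTheory/LFunctions` (T-ANT), family RH. Everything here is PROVED; one
definition (`logRemainder`), no named facts.

For a completely multiplicative `f` with `|f(p)| ≤ 1` the logarithm of its Euler product splits as
`log Σ f(n)n^{−s} = Σ_p f(p)p^{−s} + Σ_p (−Log(1 − f(p)p^{−s}) − f(p)p^{−s})`, and the second sum is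
harmless: absolutely convergent, holomorphic and BOUNDED on `Re s ≥ σ₀` for any `σ₀ > 1/2` (here
`σ₀ = 3/4`). This is the standard first step of every log-Euler-product argument (Montgomery 1983,
§3 (15)–(16): "`f(s) = f₁(s) f₃(s)` where `log f₃ ≪ Σ_p p^{−2σ}`"; Tenenbaum II.5 §5.1; Titchmarsh §3.2),
vendored once for all coefficient sequences `c : ℕ → ℂ`, `‖c‖ ≤ 1`:

* `logRemainder c s = Σ'_p (−Log(1 − c_p p^{−s}) − c_p p^{−s})`;
* `norm_logRemainderTerm_le` — termwise `‖·‖ ≤ (5/4) p^{−2σ}` for `Re s ≥ 3/4`;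
* `differentiableOn_logRemainder`, `norm_logRemainder_le` — holomorphy on `Re s > 3/4` and the
  uniform bound `‖logRemainder c s‖ ≤ (5/4) Σ_p p^{−3/2}` there;
* `LSeries_eq_exp_primeSum_add_logRemainder` — for `f : ℕ →*₀ ℂ` with `‖f‖ ≤ 1` and `Re s > 1`,
  `Σ_n f(n) n^{−s} = exp(Σ_p f(p) p^{−s} + logRemainder f s)`;
* `eulerLogZeta_eq_primeZeta_add_logRemainder` — the case `f = 1`:
  `Σ_p −Log(1 − p^{−s}) = Σ_p p^{−s} + logRemainder 1 s`, linking the tree's `eulerLogZeta`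
  (`LogZetaClassicalRegion.lean`) with the prime zeta function.

## References

* [Montgomery1983] H. L. Montgomery, *Zeros of approximations to the zeta function* (1983), §3,
  (15)–(16).
* [Tenenbaum2015] G. Tenenbaum, *Introduction to analytic and probabilistic number theory*, 3rd ed.,
  II.5 §5.1; I.1 (Euler products).
* [Titchmarsh1986] E. C. Titchmarsh, *The theory of the Riemann zeta-function*, 2nd ed., §3.2
  (`log ζ(s) = Σ_p p^{−s} + O(1)`).
-/

noncomputable section

open Complex Set Filter Topology

namespace Literature.NumberTheory.LFunctions

/-! ### The terms -/

/-- The second-order Euler term `−Log(1 − z) − z` is small: `‖−Log(1 − z) − z‖ ≤ (5/4)‖z‖²` for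
`‖z‖ ≤ 3/5` (from Mathlib's `‖Log(1 + w) − w‖ ≤ ‖w‖²(1 − ‖w‖)⁻¹/2`). [folklore] -/
theorem norm_neg_log_one_sub_sub_le' {z : ℂ} (hz : ‖z‖ ≤ 3 / 5) :
    ‖-log (1 - z) - z‖ ≤ 5 / 4 * ‖z‖ ^ 2 := by
  have h := norm_log_one_add_sub_self_le (z := -z) (by rw [norm_neg]; linarith)
  rw [norm_neg, ← sub_eq_add_neg] at h
  have e : ‖-log (1 - z) - z‖ = ‖log (1 - z) - -z‖ := by
    rw [← norm_neg]; congr 1; ring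
  rw [e]
  refine h.trans ?_
  have h1 : (1 - ‖z‖)⁻¹ ≤ 5 / 2 := by
    rw [inv_le_comm₀ (by linarith) (by norm_num)]; linarith
  have h0 : 0 ≤ ‖z‖ ^ 2 := sq_nonneg _
  calc ‖z‖ ^ 2 * (1 - ‖z‖)⁻¹ / 2 ≤ ‖z‖ ^ 2 * (5 / 2) / 2 := by gcongr
    _ = 5 / 4 * ‖z‖ ^ 2 := by ring

/-- `2^{−3/4} ≤ 3/5`. [folklore] -/
theorem two_rpow_neg_three_quarters_le : (2 : ℝ) ^ (-(3 / 4 : ℝ)) ≤ 3 / 5 := by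
  -- `(3/5)^4 = 81/625 ≥ 1/8 = (2^{-3/4})^4`
  have h1 : ((2 : ℝ) ^ (-(3 / 4 : ℝ))) ^ (4 : ℕ) = 1 / 8 := by
    rw [← Real.rpow_natCast, ← Real.rpow_mul (by norm_num)]
    norm_num
  have h0 : 0 ≤ (2 : ℝ) ^ (-(3 / 4 : ℝ)) := Real.rpow_nonneg (by norm_num) _
  by_contra h
  push Not at h
  have : ((3 : ℝ) / 5) ^ (4 : ℕ) < ((2 : ℝ) ^ (-(3 / 4 : ℝ))) ^ (4 : ℕ) :=
    pow_lt_pow_left₀ h (by norm_num) (by norm_num)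
  rw [h1] at this
  norm_num at this

/-- For a prime `p`, `‖c‖ ≤ 1` and `Re s ≥ 3/4`: `‖c p^{−s}‖ ≤ p^{−Re s} ≤ 2^{−3/4} ≤ 3/5`. [folklore] -/
theorem norm_coeff_mul_prime_cpow_le {c : ℂ} (hc : ‖c‖ ≤ 1) (p : Nat.Primes) {s : ℂ}
    (hs : 3 / 4 ≤ s.re) :
    ‖c * (p : ℂ) ^ (-s)‖ ≤ (p : ℝ) ^ (-s.re) ∧ (p : ℝ) ^ (-s.re) ≤ 3 / 5 := by
  have hp2 : (2 : ℝ) ≤ p := by exact_mod_cast p.prop.two_le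
  constructor
  · rw [norm_mul, norm_prime_cpow_neg]
    exact mul_le_of_le_one_left (Real.rpow_nonneg (by linarith) _) hc
  · calc (p : ℝ) ^ (-s.re) ≤ (2 : ℝ) ^ (-s.re) := Real.rpow_le_rpow_of_nonpos two_pos hp2 (by linarith)
      _ ≤ (2 : ℝ) ^ (-(3 / 4 : ℝ)) := Real.rpow_le_rpow_of_exponent_le one_le_two (by linarith)
      _ ≤ 3 / 5 := two_rpow_neg_three_quarters_le

/-- The `p`-th term of the remainder. [folklore] -/
def logRemainderTerm (c : ℕ → ℂ) (s : ℂ) (p : Nat.Primes) : ℂ :=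
  -log (1 - c p * (p : ℂ) ^ (-s)) - c p * (p : ℂ) ^ (-s)

/-- **Termwise bound**: `‖−Log(1 − c_p p^{−s}) − c_p p^{−s}‖ ≤ (5/4) p^{−2 Re s}` for `‖c‖ ≤ 1`,
`Re s ≥ 3/4`. [cite: Titchmarsh1986, §3.2] -/
theorem norm_logRemainderTerm_le {c : ℕ → ℂ} (hc : ∀ n, ‖c n‖ ≤ 1) {s : ℂ} (hs : 3 / 4 ≤ s.re)
    (p : Nat.Primes) : ‖logRemainderTerm c s p‖ ≤ 5 / 4 * (p : ℝ) ^ (-(2 * s.re)) := by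
  obtain ⟨h1, h2⟩ := norm_coeff_mul_prime_cpow_le (hc p) p hs
  have hp0 : (0 : ℝ) < p := by exact_mod_cast p.prop.pos
  unfold logRemainderTerm
  refine (norm_neg_log_one_sub_sub_le' (h1.trans h2)).trans ?_
  have hsq : ((p : ℝ) ^ (-s.re)) ^ 2 = (p : ℝ) ^ (-(2 * s.re)) := by
    rw [← Real.rpow_natCast, ← Real.rpow_mul hp0.le]; ring_nf
  rw [← hsq]
  gcongr

/-- The terms are holomorphic on `Re s > 3/4`. [folklore] -/
theorem differentiableOn_logRemainderTerm {c : ℕ → ℂ} (hc : ∀ n, ‖c n‖ ≤ 1) (p : Nat.Primes) :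
    DifferentiableOn ℂ (fun s ↦ logRemainderTerm c s p) {s : ℂ | 3 / 4 < s.re} := by
  intro s hs
  have hs' : 3 / 4 ≤ s.re := le_of_lt hs
  obtain ⟨h1, h2⟩ := norm_coeff_mul_prime_cpow_le (hc p) p hs'
  have hz : DifferentiableAt ℂ (fun w : ℂ ↦ c p * (p : ℂ) ^ (-w)) s :=
    (differentiableAt_id.neg.const_cpow (Or.inl (by exact_mod_cast p.prop.ne_zero))).const_mul _
  have hslit : 1 - c p * (p : ℂ) ^ (-s) ∈ slitPlane := by
    left
    have : (c p * (p : ℂ) ^ (-s)).re ≤ ‖c p * (p : ℂ) ^ (-s)‖ := re_le_norm _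
    simp only [sub_re, one_re]
    linarith
  exact ((((differentiableAt_const _).sub hz).clog hslit).neg.sub hz).differentiableWithinAt

/-! ### The remainder series -/

/-- **The second-order part of the log of an Euler product**:
`logRemainder c s = Σ'_p (−Log(1 − c_p p^{−s}) − c_p p^{−s})`. [cite: Montgomery1983, §3 (15)–(16)] -/
def logRemainder (c : ℕ → ℂ) (s : ℂ) : ℂ := ∑' p : Nat.Primes, logRemainderTerm c s p

/-- The majorant `(5/4) p^{−3/2}` is summable. [folklore] -/
theorem summable_majorant_three_halves :
    Summable fun p : Nat.Primes ↦ 5 / 4 * (p : ℝ) ^ (-(3 / 2 : ℝ)) :=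
  ((Nat.Primes.summable_rpow (r := -(3 / 2 : ℝ))).2 (by norm_num)).mul_left _

/-- Summability of the remainder for `Re s ≥ 3/4`, with `‖logRemainder c s‖ ≤ (5/4) Σ_p p^{−3/2}`.
[cite: Titchmarsh1986, §3.2] -/
theorem summable_logRemainderTerm {c : ℕ → ℂ} (hc : ∀ n, ‖c n‖ ≤ 1) {s : ℂ} (hs : 3 / 4 ≤ s.re) :
    Summable (fun p ↦ logRemainderTerm c s p) ∧
      ‖logRemainder c s‖ ≤ 5 / 4 * ∑' p : Nat.Primes, (p : ℝ) ^ (-(3 / 2 : ℝ)) := by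
  have hb : ∀ p : Nat.Primes, ‖logRemainderTerm c s p‖ ≤ 5 / 4 * (p : ℝ) ^ (-(3 / 2 : ℝ)) := by
    intro p
    refine (norm_logRemainderTerm_le hc hs p).trans ?_
    have hp1 : (1 : ℝ) ≤ p := by exact_mod_cast p.prop.one_lt.le
    exact mul_le_mul_of_nonneg_left (Real.rpow_le_rpow_of_exponent_le hp1 (by linarith)) (by norm_num)
  have hsum : Summable fun p ↦ logRemainderTerm c s p :=
    Summable.of_norm_bounded summable_majorant_three_halves hb
  refine ⟨hsum, ?_⟩
  unfold logRemainder
  calc ‖∑' p : Nat.Primes, logRemainderTerm c s p‖ ≤ ∑' p : Nat.Primes, 5 / 4 * (p : ℝ) ^ (-(3 / 2 : ℝ)) :=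
        tsum_of_norm_bounded summable_majorant_three_halves.hasSum hb
    _ = 5 / 4 * ∑' p : Nat.Primes, (p : ℝ) ^ (-(3 / 2 : ℝ)) := tsum_mul_left

/-- **Uniform bound**: `‖logRemainder c s‖ ≤ (5/4) Σ_p p^{−3/2}` for `Re s ≥ 3/4`.
[cite: Montgomery1983, §3 (16)] -/
theorem norm_logRemainder_le {c : ℕ → ℂ} (hc : ∀ n, ‖c n‖ ≤ 1) {s : ℂ} (hs : 3 / 4 ≤ s.re) :
    ‖logRemainder c s‖ ≤ 5 / 4 * ∑' p : Nat.Primes, (p : ℝ) ^ (-(3 / 2 : ℝ)) :=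
  (summable_logRemainderTerm hc hs).2

/-- **Holomorphy** of the remainder on `Re s > 3/4` (uniform convergence). [folklore] -/
theorem differentiableOn_logRemainder {c : ℕ → ℂ} (hc : ∀ n, ‖c n‖ ≤ 1) :
    DifferentiableOn ℂ (logRemainder c) {s : ℂ | 3 / 4 < s.re} := by
  have hUo : IsOpen {s : ℂ | 3 / 4 < s.re} := isOpen_lt continuous_const continuous_re
  refine differentiableOn_tsum_of_summable_norm summable_majorant_three_halves
    (fun p ↦ differentiableOn_logRemainderTerm hc p) hUo (fun p s hs ↦ ?_)
  have hs' : 3 / 4 ≤ s.re := le_of_lt hs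
  refine (norm_logRemainderTerm_le hc hs' p).trans ?_
  have hp1 : (1 : ℝ) ≤ p := by exact_mod_cast p.prop.one_lt.le
  exact mul_le_mul_of_nonneg_left (Real.rpow_le_rpow_of_exponent_le hp1 (by linarith)) (by norm_num)

/-- Continuity of the remainder on `Re s > 3/4`. [folklore] -/
theorem continuousOn_logRemainder {c : ℕ → ℂ} (hc : ∀ n, ‖c n‖ ≤ 1) :
    ContinuousOn (logRemainder c) {s : ℂ | 3 / 4 < s.re} :=
  (differentiableOn_logRemainder hc).continuousOn

/-! ### The Euler product in logarithmic form -/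

/-- The prime sum `Σ_p f(p) p^{−s}` converges absolutely for `Re s > 1` when `‖f‖ ≤ 1`. [folklore] -/
theorem summable_coeff_mul_prime_cpow {c : ℕ → ℂ} (hc : ∀ n, ‖c n‖ ≤ 1) {s : ℂ} (hs : 1 < s.re) :
    Summable fun p : Nat.Primes ↦ c p * (p : ℂ) ^ (-s) := by
  refine Summable.of_norm_bounded ((Nat.Primes.summable_rpow (r := -s.re)).2 (by linarith)) fun p ↦ ?_
  rw [norm_mul, norm_prime_cpow_neg]
  exact mul_le_of_le_one_left (Real.rpow_nonneg (Nat.cast_nonneg _) _) (hc p)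

/-- **The Euler product, logarithmic form.** For a completely multiplicative `f : ℕ →*₀ ℂ` with
`‖f(n)‖ ≤ 1` and `Re s > 1`:
`Σ_n f(n) n^{−s} = exp( Σ_p f(p) p^{−s} + logRemainder f s )`.
(Mathlib's `EulerProduct.exp_tsum_primes_log_eq_tsum` for the hom `n ↦ f(n) n^{−s}`, then
`−Log(1 − z) = z + (−Log(1 − z) − z)` termwise.) [cite: Tenenbaum2015, II.5 §5.1]
[cite: Montgomery1983, §3 (15)] -/
theorem LSeries_eq_exp_primeSum_add_logRemainder (f : ℕ →*₀ ℂ) (hf : ∀ n, ‖f n‖ ≤ 1) {s : ℂ}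
    (hs : 1 < s.re) :
    LSeries (f ·) s = exp ((∑' p : Nat.Primes, f p * (p : ℂ) ^ (-s)) + logRemainder (f ·) s) := by
  have hs0 : s ≠ 0 := fun h ↦ by rw [h, zero_re] at hs; linarith
  set g : ℕ →*₀ ℂ := f * riemannZetaSummandHom hs0 with hg
  have hgn : ∀ n : ℕ, ‖g n‖ ≤ (n : ℝ) ^ (-s.re) := norm_mul_summandHom_le' f hf hs0
  have hsum : Summable (‖g ·‖) :=
    Summable.of_nonneg_of_le (fun n ↦ norm_nonneg _) hgn (Real.summable_nat_rpow.2 (by linarith))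
  have hE := EulerProduct.exp_tsum_primes_log_eq_tsum hsum
  rw [tsum_mul_summandHom_eq_LSeries' f hs0] at hE
  rw [← hE]
  congr 1
  -- `g p = f p · p^{−s}`
  have hgp : ∀ p : Nat.Primes, g p = f p * (p : ℂ) ^ (-s) := by
    intro p
    rw [hg, mulHom_apply]
    simp [riemannZetaSummandHom, cpow_neg]
  simp_rw [hgp]
  have h1 := summable_coeff_mul_prime_cpow hf hs
  have h2 := (summable_logRemainderTerm (c := (f ·)) hf (s := s) (by linarith)).1
  rw [logRemainder, ← h1.tsum_add h2]
  refine tsum_congr fun p ↦ ?_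
  simp only [logRemainderTerm]
  ring

/-- **The prime zeta function and `log ζ`**: for `Re s > 1`,
`eulerLogZeta s = Σ_p p^{−s} + logRemainder 1 s`, i.e. `log ζ(s) = Σ_p p^{−s} + O(1)`
(Titchmarsh §3.2), with the tree's `eulerLogZeta` of `LogZetaClassicalRegion.lean`.
[cite: Titchmarsh1986, §3.2] -/
theorem eulerLogZeta_eq_primeZeta_add_logRemainder {s : ℂ} (hs : 1 < s.re) :
    eulerLogZeta s = (∑' p : Nat.Primes, (p : ℂ) ^ (-s)) + logRemainder (fun _ ↦ 1) s := by
  have h1 : Summable fun p : Nat.Primes ↦ (p : ℂ) ^ (-s) := by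
    simpa using summable_coeff_mul_prime_cpow (c := fun _ ↦ (1 : ℂ)) (fun _ ↦ by simp) hs
  have h2 := (summable_logRemainderTerm (c := fun _ ↦ (1 : ℂ)) (fun _ ↦ by simp) (s := s)
    (by linarith)).1
  rw [eulerLogZeta, logRemainder, ← h1.tsum_add h2]
  refine tsum_congr fun p ↦ ?_
  simp only [logRemainderTerm, one_mul]
  ring

end Literature.NumberTheory.LFunctions

end
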